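import Literature.Analysis.FluidPDE.ChaeWolfRemovingDSSProofs
import HarnessLib

/-!
# The `analytic_window` rung AS TYPED is Chae–Wolf 2017 Thm 1.3 — refuter side, negative lane

Crux `stmt-NavierStokesRegularity-24077` (`QuarterLogPincer.TypeIQuantSubcubicExp`), rung line
`Cruxes/TypeIQuantSubcubicExp/Lines/analytic_window.lean` (ns-idea-7 g6, v2 9b3e71be3aac: one `sorry` = S2
`stub_profileGevreyBound`).  Typed-strength (costume) check of the line's displayed RUNG

  `analyticWindow_rung : ∀ C₀ > 0, ∃ δ₀ θ C₁, 0 < δ₀ ≤ 1 ∧ 0 < θ ≤ 1 ∧ 1 ≤ C₁ ∧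
     ∀ c, 1 < c → c ≤ exp(θ / (4 log(9C₁/(θδ₀)))) → (classical ancient ∧ c-DSS ∧ HasTypeIDecay C₀ ⇒ u ≡ 0)`.

FINDING (kernel-checked below, pure real arithmetic): because `δ₀, θ, C₁` are bound by `∃` with RANGE
constraints only (they are not tied to `OneSliceThresholdAt` / `ProfileGevreyBound` in the rung), and the
displayed window `exp(θ/(4 log(9C₁/(θδ₀))))` is `> 1` on the admissible ranges and tends to `1` as `θ → 0⁺`
(`C₁ = δ₀ = 1`), the rung statement is EQUIVALENT to the Literature statement
`Literature.Analysis.FluidPDE.chaeWolf2017_removing_dss` (Chae–Wolf 2017 Thm 1.3: `∀ C₀ > 0, ∃ c₁ > 1, …`),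
which is a tree THEOREM (`chaeWolf2017_removing_dss_holds`).  Hence `analyticWindowRung_holds`: the rung
holds UNCONDITIONALLY, without S2, without S1, without the `flat_window` obligations.

READING for the lead / critic / line owner (fairness: the card itself says «Transfer: none (same conclusion
shape as Chae–Wolf 1.3 / PV 1.6 / tree `removingDss_explicitWindow`); the gain is the threshold dependence
`δ₀ ↦ θ/|log δ₀|`»): that gain is real on paper but INVISIBLE at the typed level of the `∃`-closed rung; the
line's typed content is the CONDITIONAL theorem `removingDss_analyticWindow_of` (hypotheses
`OneSliceThresholdAt C₀ δ₀ Cp s₀`, `AnnulusPressure C₀ Cp`, `ProfileGevreyBound C₀ R C₁ θ` explicit, window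
`2 log λ ≤ θ/(2 log(9C₁/(θδ₀)))` displayed in THOSE parameters) together with `flatOnBall_of_window` and
`gevreyFlatness_holds` — all three already sorry-free in the line file v2.  Consequently the open stub S2
`stub_profileGevreyBound` (size L) discharges NO typed statement the tree lacks: it only inhabits
`ProfileGevreyBound`, a Literature-grade regularity fact (Gevrey-1 profile lines of envelope-class classical
ancient solutions).  No prover time on the crux is bought by S2; if the fact is wanted, it is a Literature
filing.  (The same `∃`-closure remark applies to every «window = formula in ∃-bound constants» rung; the
sibling `removingDss_explicitWindow` at least ties `δ₀, B` to `OneSliceThreshold` / `AccelerationBound`, but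
by monotonicity of those predicates its `∃`-closure is likewise Chae–Wolf 1.3 plus their inhabitation.)

Nothing here asserts S3, the crux 24077, or any Theses statement; no summit statement is proved by this
file; the near-one cell of the DSS census stays «∃ λ₀(C₀) > 1, non-numeric».
-/

-- the summit and its single sub-problem share the name (CONVENTIONS §1), as in every Theorems file
set_option linter.dupNamespace false

namespace Summit.NavierStokesRegularity.NavierStokesRegularity.Theorems.TypeIQuantSubcubicExp.Negative

open Set
open Literature.Analysis Literature.Analysis.FluidPDE

/-! ### 1. Arithmetic of the displayed window -/

/-- On the admissible ranges the displayed window exceeds `1`. [folklore] -/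
theorem one_lt_analyticWindow {δ₀ θ C₁ : ℝ} (hδ₀ : 0 < δ₀) (hδ₁ : δ₀ ≤ 1) (hθ : 0 < θ)
    (hθ1 : θ ≤ 1) (hC₁ : 1 ≤ C₁) :
    1 < Real.exp (θ / (4 * Real.log (9 * C₁ / (θ * δ₀)))) := by
  rw [Real.one_lt_exp_iff]
  refine div_pos hθ (mul_pos (by norm_num) (Real.log_pos ?_))
  rw [lt_div_iff₀ (mul_pos hθ hδ₀)]
  nlinarith [mul_le_mul hθ1 hδ₁ hδ₀.le zero_le_one]

/-- `log 9 > 2` (from `e < 2.7182818286`). [folklore] -/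
theorem two_lt_log_nine : 2 < Real.log 9 := by
  rw [Real.lt_log_iff_exp_lt (by norm_num)]
  have h1 := Real.exp_one_lt_d9
  have h0 := Real.exp_pos 1
  have h2 : Real.exp 2 = Real.exp 1 * Real.exp 1 := by
    rw [← Real.exp_add]; norm_num
  rw [h2]
  nlinarith

/-- The displayed window shrinks to `1`: with `C₁ = δ₀ = 1` and `θ = min 1 ℓ` it is `< exp ℓ` for every
`ℓ > 0`. [folklore] -/
theorem analyticWindow_lt_exp {ℓ : ℝ} (hℓ : 0 < ℓ) :
    Real.exp (min 1 ℓ / (4 * Real.log (9 * 1 / (min 1 ℓ * 1)))) < Real.exp ℓ := by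
  have hθ : 0 < min 1 ℓ := lt_min one_pos hℓ
  have hθ1 : min 1 ℓ ≤ 1 := min_le_left _ _
  have hθℓ : min 1 ℓ ≤ ℓ := min_le_right _ _
  rw [Real.exp_lt_exp]
  have hlog : Real.log 9 ≤ Real.log (9 * 1 / (min 1 ℓ * 1)) := by
    apply Real.log_le_log (by norm_num)
    rw [mul_one, mul_one, le_div_iff₀ hθ]
    nlinarith
  have h9 := two_lt_log_nine
  have hden : (8 : ℝ) ≤ 4 * Real.log (9 * 1 / (min 1 ℓ * 1)) := by linarith
  calc min 1 ℓ / (4 * Real.log (9 * 1 / (min 1 ℓ * 1)))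
      ≤ min 1 ℓ / 8 := div_le_div_of_nonneg_left hθ.le (by norm_num) hden
    _ < ℓ := by linarith

/-! ### 2. The rung as typed ⟺ Chae–Wolf 2017 Thm 1.3 -/

/-- **Chae–Wolf 1.3 ⇒ the `analytic_window` rung as typed** (choose `δ₀ = C₁ = 1`, `θ = min 1 (log c₁)`).
[folklore] -/
theorem analyticWindowRung_of_chaeWolf (h : chaeWolf2017_removing_dss) :
    ∀ C₀ : ℝ, 0 < C₀ → ∃ δ₀ θ C₁ : ℝ, 0 < δ₀ ∧ δ₀ ≤ 1 ∧ 0 < θ ∧ θ ≤ 1 ∧ 1 ≤ C₁ ∧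
      ∀ c : ℝ, 1 < c → c ≤ Real.exp (θ / (4 * Real.log (9 * C₁ / (θ * δ₀)))) →
        ∀ (u : ℝ → EuclideanSpace ℝ (Fin 3) → EuclideanSpace ℝ (Fin 3))
          (p : ℝ → EuclideanSpace ℝ (Fin 3) → ℝ),
          IsClassicalNSSolutionOn (Iio 0) 1 0 u p → IsDiscretelySelfSimilar c u → HasTypeIDecay C₀ u →
          ∀ t < 0, ∀ x, u t x = 0 := by
  intro C₀ hC₀
  obtain ⟨c₁, hc₁, hW⟩ := h C₀ hC₀
  have hℓ : 0 < Real.log c₁ := Real.log_pos hc₁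
  refine ⟨1, min 1 (Real.log c₁), 1, one_pos, le_rfl, lt_min one_pos hℓ, min_le_left _ _, le_rfl, ?_⟩
  intro c hc hcc u p hsol hdss hdec
  have hlt : c < c₁ := by
    have hE := analyticWindow_lt_exp hℓ
    rw [Real.exp_log (lt_trans zero_lt_one hc₁)] at hE
    exact lt_of_le_of_lt hcc hE
  exact hW c hc hlt u p hsol hdss hdec

/-- **The `analytic_window` rung as typed ⇒ Chae–Wolf 1.3** (take `c₁` = the displayed window). [folklore] -/
theorem chaeWolf_of_analyticWindowRung
    (h : ∀ C₀ : ℝ, 0 < C₀ → ∃ δ₀ θ C₁ : ℝ, 0 < δ₀ ∧ δ₀ ≤ 1 ∧ 0 < θ ∧ θ ≤ 1 ∧ 1 ≤ C₁ ∧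
      ∀ c : ℝ, 1 < c → c ≤ Real.exp (θ / (4 * Real.log (9 * C₁ / (θ * δ₀)))) →
        ∀ (u : ℝ → EuclideanSpace ℝ (Fin 3) → EuclideanSpace ℝ (Fin 3))
          (p : ℝ → EuclideanSpace ℝ (Fin 3) → ℝ),
          IsClassicalNSSolutionOn (Iio 0) 1 0 u p → IsDiscretelySelfSimilar c u → HasTypeIDecay C₀ u →
          ∀ t < 0, ∀ x, u t x = 0) :
    chaeWolf2017_removing_dss := by
  intro C₀ hC₀
  obtain ⟨δ₀, θ, C₁, hδ₀, hδ₁, hθ, hθ1, hC₁, hW⟩ := h C₀ hC₀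
  refine ⟨Real.exp (θ / (4 * Real.log (9 * C₁ / (θ * δ₀)))),
    one_lt_analyticWindow hδ₀ hδ₁ hθ hθ1 hC₁, ?_⟩
  intro c hc hcc u p hsol hdss hdec
  exact hW c hc hcc.le u p hsol hdss hdec

/-- **The `analytic_window` rung as typed holds UNCONDITIONALLY** — from the tree theorem
`chaeWolf2017_removing_dss_holds` alone (no `stub_profileGevreyBound`, no `stub_gevreyFlatness`, no
`flat_window` obligation). [folklore] -/
theorem analyticWindowRung_holds :
    ∀ C₀ : ℝ, 0 < C₀ → ∃ δ₀ θ C₁ : ℝ, 0 < δ₀ ∧ δ₀ ≤ 1 ∧ 0 < θ ∧ θ ≤ 1 ∧ 1 ≤ C₁ ∧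
      ∀ c : ℝ, 1 < c → c ≤ Real.exp (θ / (4 * Real.log (9 * C₁ / (θ * δ₀)))) →
        ∀ (u : ℝ → EuclideanSpace ℝ (Fin 3) → EuclideanSpace ℝ (Fin 3))
          (p : ℝ → EuclideanSpace ℝ (Fin 3) → ℝ),
          IsClassicalNSSolutionOn (Iio 0) 1 0 u p → IsDiscretelySelfSimilar c u → HasTypeIDecay C₀ u →
          ∀ t < 0, ∀ x, u t x = 0 :=
  analyticWindowRung_of_chaeWolf chaeWolf2017_removing_dss_holds

end Summit.NavierStokesRegularity.NavierStokesRegularity.Theorems.TypeIQuantSubcubicExp.Negative
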